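import Summits.BirchSwinnertonDyer.BirchSwinnertonDyer.Theorems.AdditiveKolyvaginRoadLevelKolyvaginSystemsAdditiveGammaLocus
import Summits.BirchSwinnertonDyer.BirchSwinnertonDyer.Theorems.AdditiveKolyvaginRoadLevelKolyvaginSystemsAdditiveStubTamagawaOffP
import Summits.BirchSwinnertonDyer.BirchSwinnertonDyer.Theorems.AdditiveKolyvaginRoadLevelKolyvaginSystemsAdditiveStubLenderSeed
import Summits.BirchSwinnertonDyer.Rank1Residual.O5.HeegnerLogTransportThreeChain
import Summits.BirchSwinnertonDyer.BirchSwinnertonDyer.Theorems.AdditiveKolyvaginRoadLevelSystemsCoreConnectedOfPoitouTate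
import Summits.BirchSwinnertonDyer.BirchSwinnertonDyer.Theorems.AdditiveKolyvaginRoadLevelSystemsOfSeedAtFrame
import Summits.BirchSwinnertonDyer.BirchSwinnertonDyer.Theorems.AdditiveKolyvaginRoadLevelSystemsTransfer
import Summits.BirchSwinnertonDyer.BirchSwinnertonDyer.Theorems.AdditiveKolyvaginRoadBottomRankOneAdditiveClassOfPoint
import Summits.BirchSwinnertonDyer.BirchSwinnertonDyer.Theorems.AdditiveKolyvaginRoadBottomRankOneAdditiveNonTorsion
import Literature.NumberTheory.EllipticCurves.HeegnerPointsOfConductorOneData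
import HarnessLib

/-!
# Route `AdditiveKolyvaginRoad`, crux KS′ `LevelKolyvaginSystemsAdditive` (item stmt-BirchSwinnertonDyer-21396):
# registered stub S5b `stub_lenderCoreConnected` of line `epsilon_matched_retyping` (skeleton v4, sha16 17b1a085) — PROVED:
# the LENDER's core graph is connected from the bottom, by TRANSPORT of `selQP_coreConnected` along the torsion congruence
# (cell `pub/bsd-wall`, width seat `bsd-wall-akr-p2x-w3` g5; `--supports stmt-BirchSwinnertonDyer-21396`)

WHAT. At a (γ)-avatar frame of the line (E = `W` additive at `p ≥ 5`, avatar E₀ = `W₀` good non-anomalous at `p`, `Γ_ℚ`-equivariant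
`e : E[p] ≃ E₀[p]`, `hrad`, `htype`, (θK)ₚ in the shape `hKumP`, the lender's seed `hseed₀ : ∀ d₀, c_{E₀}(1) ≠ 0`), every non-empty
even admissible level `n` of `E₀` of total canonical rank one is joined to `∅` in Howard's core graph of `E₀`'s level-Selmer lattice
(`SelQP W₀ K p c`).  ROAD (the lead's, cruxlead-21396 g0 05:53Z): E's core graph IS connected at the ♯ frame — the tree's
`AdditiveKoly.selQP_coreConnected_of_poitouTate` (Howard Prop. 2.4.11 for the canonical spaces, (R′) from Poitou–Tate = DUAL.2, odd
bottom rank from PUB ∧ DUAL by `odd_finrank_selQP_empty_of_published`) — and the two lattices are ISOMORPHIC along the congruence: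
`θ := stub_torsionIsoBaseChange` (landed S2), `θ_* = h1Equiv θ`, the admissible primes correspond (`isAdmissiblePrime_iff_of_congr`,
Kraus–Oesterlé trace congruence `dvd_frobeniusTrace_sub_of_addEquiv_geomTorsion` off `pN`), and `θ_*` identifies the canonical spaces
level by level (`finrank_selQP_eq_of_congr`: (θc) `h1Equiv_conjAct`, (θT) `h1Equiv_mem_toricLocalKer_iff`, (θK) = `hKumP` above `p`,
Gross (7.1) `h1Equiv_mem_selmerLocalKer_iff_of_hasGoodReductionAt` at the good places, (Tam) = landed S3 `stub_tamagawaOffP` +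
`h1Equiv_mem_selmerLocalKer_iff_of_not_dvd_localTamagawaNumber` at the bad places prime to `p`).  The starting level `∅` has total
rank `≤ 1` for E because it has rank EXACTLY `1` for E₀: the seed `c_{E₀}(1) ≠ 0` at the conductor-one datum
(`exists_kolyvaginHeegnerData_one`, PUB's `phi_heegnerTau_mem_singularModuliField`) says `y_K ∉ p·E₀(K)`
(`kolyvaginClass_one_ne_zero_iff_not_exists_zsmul_eq` at `W₀`), whence `#Sel_p(E₀/K) = p` by Kolyvagin (`kolyvagin`,
`Kolyvagin1990_padicValNat_card_sha_le` — both in PUB — exactly as in the lead's `finrank_selQP_empty_add_eq_one_of_certificate`).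
Howard's path in E's lattice is then pushed to E₀'s lattice edge by edge (induction on `EqvGen`).

* §1 `natCard_inf_torsionBy_eq_one_of_not_dvd_card` — a finite subgroup of order prime to `p` meets the `p`-torsion trivially (Cauchy);
  `finrank_selQP_empty_add_eq_one_of_heegnerPoint_not_pDivisible` — `#Sel_p(E₀/K) = p` from a Heegner point `y ∉ p·E₀(K)` (the road of
  the lead's `finrank_selQP_empty_add_eq_one_of_certificate`, `…LenderBottomRank`, with the `ℚ_p`-step removed; the index lemma is O5's
  `HeegnerLogTransport.padicValNat_index_zmultiples_eq_zero`), and `finrank_selQP_empty_add_eq_one_of_seed` — the same from `hseed₀`.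
* §2 `stub_lenderCoreConnected` — the registered signature VERBATIM.

HONEST FRAMING: theorems only; 0 definitions, 0 named facts, 0 `sorry`; the named published inputs (PUB, DUAL, Kriz–Li) are HYPOTHESES of
the registered signature (only PUB's Kolyvagin ∕ Darmon conjuncts and DUAL's Poitou–Tate conjunct are used; `hKL` is not used).  Closes the
stub, not the crux; KS′ is not proved by this; BSD is not proved by any of this.

References: [cite: Howard2006Bipartite, Lemma 2.4.10, Prop. 2.4.11] [cite: WZhang2014, Lemma 5.3, Prop. 5.4, §9] [cite: GrossLMS1991, §1
Thm. 1.3, §4 (4.4), §7 (7.1)] [cite: KolyvaginEulerSystems1990, Thm. A] [cite: KrausOesterle1992, §3 Prop. 3] [cite: BertoliniDarmon2005,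
p. 18, §2.2–§2.3].
-/

set_option linter.dupNamespace false -- single-conjunct summit repeats the name by design

noncomputable section

open scoped Classical

namespace Summit.BirchSwinnertonDyer.BirchSwinnertonDyer.Theorems.AdditiveKoly

open WeierstrassCurve NumberField IsDedekindDomain Field
  Literature.NumberTheory.EllipticCurves Literature.NumberTheory.EllipticCurves.ModularForms
  Literature.NumberTheory.EllipticCurves.Rank1Residual Literature.NumberTheory.GaloisRepresentations
  Literature.NumberTheory.GaloisCohomology Module Summit.BirchSwinnertonDyer.Rank1Residual
  Summit.BirchSwinnertonDyer.Rank1Residual.X11b.Three.Koly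
  Summit.BirchSwinnertonDyer.BirchSwinnertonDyer.Theses.AdditiveKolyvaginRoad

/-! ## §1 The lender's bottom rank is one, from the seed -/

section Lender

variable (W₀ : WeierstrassCurve ℚ) [W₀.IsElliptic] [W₀.IsGloballyMinimal] [NeZero (W₀.conductorNorm ℤ)]
  (p : ℕ) [hp : Fact p.Prime] (K : Type) [Field K] [NumberField K] (c : K ≃ₐ[ℚ] K)
  [Module (ZMod p) (Vp W₀ K p)]

/-- **A finite subgroup of order prime to `p` meets the `p`-torsion trivially**: for a finite subgroup `S ≤ B` with `p ∤ #S`,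
`#(S ⊓ B[p]) = 1` — an element of prime order `q` in `S ⊓ B[p]` (Cauchy) is killed by `p`, so `q = p ∣ #(S ⊓ B[p]) ∣ #S`.  (Applied to
`S = Ш(E₀/K)`.) [folklore] -/
theorem natCard_inf_torsionBy_eq_one_of_not_dvd_card {B : Type*} [AddCommGroup B] (S : AddSubgroup B) [Finite S] {p : ℕ}
    [hp : Fact p.Prime] (h : ¬ p ∣ Nat.card S) :
    Nat.card (S ⊓ AddSubgroup.torsionBy B ((p ^ 1 : ℕ) : ℤ) : AddSubgroup B) = 1 := by
  set H : AddSubgroup B := S ⊓ AddSubgroup.torsionBy B ((p ^ 1 : ℕ) : ℤ) with hH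
  have hle : H ≤ S := inf_le_left
  haveI : Finite H := Finite.of_injective _ (AddSubgroup.inclusion_injective hle)
  have hdvd : Nat.card H ∣ Nat.card S := AddSubgroup.card_dvd_of_le hle
  by_contra h1
  obtain ⟨q, hq, hqH⟩ := Nat.exists_prime_and_dvd h1
  haveI : Fact q.Prime := ⟨hq⟩
  obtain ⟨x, hx⟩ := exists_prime_addOrderOf_dvd_card' (G := H) q hqH
  -- `x` is killed by `p`, so its order `q` divides `p`: `q = p`
  have hpx : p • x = 0 := by
    apply Subtype.ext
    have hx2 : (x : B) ∈ AddSubgroup.torsionBy B ((p ^ 1 : ℕ) : ℤ) := (AddSubgroup.mem_inf.mp x.2).2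
    rw [AddSubgroup.torsionBy, Submodule.mem_toAddSubgroup, Submodule.mem_torsionBy_iff, pow_one, natCast_zsmul] at hx2
    rw [AddSubmonoidClass.coe_nsmul, ZeroMemClass.coe_zero]
    exact hx2
  have hqp : q ∣ p := hx ▸ addOrderOf_dvd_of_nsmul_eq_zero hpx
  have hqp' : q = p := (Nat.prime_dvd_prime_iff_eq hq hp.out).mp hqp
  subst hqp'
  exact h (hqH.trans hdvd)

/-- **`#Sel_p(E₀/K) = p` from a Heegner point not divisible by `p` in `E₀(K)`** (the lead's
`finrank_selQP_empty_add_eq_one_of_certificate` with the `ℚ_p`-certificate replaced by its `K`-rational consequence): `E₀ = W₀` globally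
minimal, `p ≥ 5`, `ρ̄_{E₀,p}` onto, `K` imaginary quadratic Heegner for `N₀`, Kolyvagin's theorem and bound at `(N₀, E₀, K)`; a Heegner point
`y ∈ E₀(K)` with `y ∉ p·E₀(K)` is of infinite order (`E₀(K)[p] = 0`), Kolyvagin gives rank one, `Ш(E₀/K)` finite with `ord_p #Ш ≤ 2·ord_p
[E₀(K) : ℤy] = 0`, and the descent count gives `#Sel_p = p`, i.e. `dim Sel_∅⁺ + dim Sel_∅⁻ = 1`. [cite: GrossLMS1991, §1 Thm. 1.3]
[cite: KolyvaginEulerSystems1990, Thm. A] [cite: SilvermanAEC2009, Thm. X.4.2] -/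
theorem finrank_selQP_empty_add_eq_one_of_heegnerPoint_not_pDivisible
    (hKo : kolyvagin (W₀.conductorNorm ℤ) W₀ K) (hB : Kolyvagin1990_padicValNat_card_sha_le (W₀.conductorNorm ℤ) W₀ K)
    (hp5 : 5 ≤ p) (hs₀ : W₀.HasSurjectiveModNGaloisRep p) (hK : IsImaginaryQuadratic K)
    (hH₀ : SatisfiesHeegnerHypothesis (W₀.conductorNorm ℤ) K) {y₀ : (W₀.baseChange K).toAffine.Point}
    (hy₀ : IsHeegnerPoint (W₀.conductorNorm ℤ) W₀ K y₀)
    (hndivK : ¬ ∃ Q : (W₀.baseChange K).toAffine.Point, (p : ℤ) • Q = y₀) :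
    finrank (ZMod p) (SelQP W₀ K p c ∅ true) + finrank (ZMod p) (SelQP W₀ K p c ∅ false) = 1 := by
  have hpp : p.Prime := hp.out
  have hp2 : p ≠ 2 := by omega
  have hcc : c * c = 1 := Method2.algEquiv_mul_self_eq_one K hK c
  rw [finrank_selQP_empty_add_eq_one_iff W₀ K p hp2 hK c hcc]
  haveI : NeZero (p : ℚ) := ⟨by exact_mod_cast hpp.ne_zero⟩
  have hirr : W₀.HasIrreducibleModPGaloisRep p := hasIrreducibleModPGaloisRep_of_hasSurjectiveModNGaloisRep W₀ p hs₀
  -- `y₀` has infinite order (no `p`-torsion over `K`)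
  have hnt : ¬ IsOfFinAddOrder y₀ := not_isOfFinAddOrder_of_not_exists_zsmul_eq W₀ hK hpp hirr hndivK
  -- Kolyvagin: rank one, `Ш(E₀/K)` finite
  obtain ⟨hrank, hfin⟩ := hKo hK hH₀ hy₀ hnt
  have htors : AddSubgroup.torsionBy (W₀.baseChange K).toAffine.Point (p : ℤ) = ⊥ :=
    torsionBy_eq_bot_of_isImaginaryQuadratic_of_hasIrreducibleModPGaloisRep W₀ K hK hpp hirr
  have hA : ∀ R : (W₀.baseChange K).toAffine.Point, p • R = 0 → R = 0 := fun R hR ↦ by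
    have hmem : R ∈ AddSubgroup.torsionBy (W₀.baseChange K).toAffine.Point (p : ℤ) := by
      rw [AddSubgroup.torsionBy, Submodule.mem_toAddSubgroup, Submodule.mem_torsionBy_iff, natCast_zsmul]
      exact hR
    rw [htors] at hmem
    exact (AddSubgroup.mem_bot).mp hmem
  have hP : ∀ Q : (W₀.baseChange K).toAffine.Point, p • Q ≠ y₀ := fun Q hQ ↦
    hndivK ⟨Q, by rw [← natCast_zsmul] at hQ; exact hQ⟩
  -- `ord_p [E₀(K) : ℤ y₀] = 0`, hence `ord_p #Ш(E₀/K) = 0` (Kolyvagin's bound), hence `#Ш[p] = 1`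
  have hidx : padicValNat p (AddSubgroup.zmultiples y₀).index = 0 :=
    O5.HeegnerLogTransport.padicValNat_index_zmultiples_eq_zero hA hP
  have hsha0 : padicValNat p (Nat.card (W₀.baseChange K).sha) = 0 := by
    have := hB hK hH₀ hy₀ hnt hpp hp2 hs₀
    omega
  haveI : Finite (W₀.baseChange K).sha := hfin
  have hsha : ¬ p ∣ Nat.card (W₀.baseChange K).sha := fun hd ↦ by
    have hne : Nat.card (W₀.baseChange K).sha ≠ 0 := Nat.card_pos.ne'
    have := (padicValNat.eq_zero_iff.mp hsha0)
    rcases this with h1 | h0 | hnd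
    · exact hpp.one_lt.ne' h1
    · exact hne h0
    · exact hnd hd
  have hShap : Nat.card ((W₀.baseChange K).sha ⊓ AddSubgroup.torsionBy (W₀.baseChange K).galH1 ((p ^ 1 : ℕ) : ℤ) :
      AddSubgroup (W₀.baseChange K).galH1) = 1 := natCard_inf_torsionBy_eq_one_of_not_dvd_card _ hsha
  have htor1 : Nat.card (AddSubgroup.torsionBy (W₀.baseChange K).toAffine.Point (((p ^ 1 : ℕ) : ℤ))) = 1 := by
    rw [pow_one, htors, AddSubgroup.card_bot]
  rw [(W₀.baseChange K).natCard_selmerGroup_eq (n := p ^ 1) (pow_ne_zero 1 hpp.ne_zero), hrank, htor1, hShap, pow_one,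
    pow_one, mul_one, mul_one]

/-- **`#Sel_p(E₀/K) = p` from the lender's SEED `∀ d₀, c_{E₀}(1) ≠ 0`** (the hypothesis `hseed₀` of stub S5b): the conductor-one
Kolyvagin–Heegner datum exists (`exists_kolyvaginHeegnerData_one`, granted Darmon's `phi_heegnerTau_mem_singularModuliField` = the last
conjunct of `PublishedInputsAdditiveKoly`), its class is non-zero, so its Heegner point `y_K ∈ E₀(K)` (over `heegnerPointComplex Dt₀ H`,
`exists_heegnerPoint_over_derivedPoint_one_of_β`) is not `p`-divisible in `E₀(K)` (`kolyvaginClass_one_ne_zero_iff_not_exists_zsmul_eq`);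
conclude by the previous theorem. [cite: GrossLMS1991, §4 (4.4)] [cite: McCallumLMS1991, Cor. 4.5] [cite: KolyvaginEulerSystems1990, Thm. A] -/
theorem finrank_selQP_empty_add_eq_one_of_seed (hPUB : PublishedInputsAdditiveKoly)
    (Dt₀ : ModularParametrizationData W₀ (W₀.conductorNorm ℤ)) (β₀ : ℤ) (ι : K →+* ℂ)
    (hp5 : 5 ≤ p) (hs₀ : W₀.HasSurjectiveModNGaloisRep p) (hK : IsImaginaryQuadratic K) (hlt : NumberField.discr K < -4)
    (hH₀ : SatisfiesHeegnerHypothesis (W₀.conductorNorm ℤ) K) (hβ₀ : (4 * (W₀.conductorNorm ℤ : ℤ)) ∣ β₀ ^ 2 - NumberField.discr K)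
    (hseed₀ : ∀ d₀ : KolyvaginHeegnerData Dt₀ β₀ ι 1, d₀.kolyvaginClass (Fact.out : p.Prime) 1 ≠ 0) :
    finrank (ZMod p) (SelQP W₀ K p c ∅ true) + finrank (ZMod p) (SelQP W₀ K p c ∅ false) = 1 := by
  obtain ⟨d₀⟩ := exists_kolyvaginHeegnerData_one (hPUB.2.2.2.2.2.2.2.2.2 (W₀.conductorNorm ℤ) W₀ K) hK Dt₀ β₀ ι hβ₀
  obtain ⟨P₀, H, -, hP₀, hP₀H⟩ := exists_heegnerPoint_over_derivedPoint_one_of_β W₀ K Dt₀ β₀ ι hK hH₀ d₀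
  have hndivK : ¬ ∃ Q : (W₀.baseChange K).toAffine.Point, (p : ℤ) • Q = P₀ :=
    (kolyvaginClass_one_ne_zero_iff_not_exists_zsmul_eq W₀ p K Dt₀ β₀ ι hp5 hs₀ hK hlt hH₀ d₀ P₀ hP₀).mp (hseed₀ d₀)
  exact finrank_selQP_empty_add_eq_one_of_heegnerPoint_not_pDivisible W₀ p K c (hPUB.2.1 (W₀.conductorNorm ℤ) W₀ K)
    (hPUB.2.2.1 (W₀.conductorNorm ℤ) W₀ K) hp5 hs₀ hK hH₀ ⟨Dt₀, H, ι, hP₀H⟩ hndivK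

end Lender

/-! ## §2 The registered stub S5b -/

-- the registered signature carries the whole avatar frame; most binders are not needed by the transport road
set_option linter.unusedVariables false in
/-- **Registered stub S5b `stub_lenderCoreConnected` of line `epsilon_matched_retyping` (skeleton v4, sha16 17b1a085), VERBATIM signature,
PROVED** — CORE-CONNECTIVITY OF THE LENDER's level-Selmer graph FROM THE BOTTOM: at an avatar frame, every non-empty even admissible
level of `E₀` of total canonical rank one is joined to `∅` in Howard's core graph of `E₀` (edges `a — a ∪ {q}`, the odd end having
`Sel^± = 0`).  Proof: `AdditiveKoly.selQP_coreConnected_of_poitouTate` at the ♯ frame of `E` (Poitou–Tate over `K` = DUAL.2, odd bottom rank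
= `odd_finrank_selQP_empty_of_published`, bottom rank of `E` = bottom rank of `E₀` = 1 by `finrank_selQP_empty_add_eq_one_of_seed`),
transported to `E₀` along `θ = stub_torsionIsoBaseChange` through the level-by-level dictionary `finrank_selQP_eq_of_congr`
(admissible primes matched by `isAdmissiblePrime_iff_of_congr` + Kraus–Oesterlé; local identifications (θc) `h1Equiv_conjAct`,
(θT) `h1Equiv_mem_toricLocalKer_iff`, (θK) = `hKumP` above `p` ∕ Gross (7.1) at good places ∕ (Tam) `stub_tamagawaOffP` at the bad places
prime to `p`), then induction on `EqvGen`. [cite: Howard2006Bipartite, Prop. 2.4.11] [cite: WZhang2014, Lemma 5.3, Prop. 5.4, §9]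
[cite: Kolyvagin1991, Thm. 4] [cite: KrausOesterle1992, §3 Prop. 3] -/
theorem stub_lenderCoreConnected (W W₀ : WeierstrassCurve ℚ) [W.IsElliptic] [W.IsGloballyMinimal] [NeZero (W.conductorNorm ℤ)]
    [W₀.IsElliptic] [W₀.IsGloballyMinimal] [NeZero (W₀.conductorNorm ℤ)] (p : ℕ) [Fact p.Prime]
    (K : Type) [Field K] [NumberField K] (Dt : ModularParametrizationData W (W.conductorNorm ℤ))
    (Dt₀ : ModularParametrizationData W₀ (W₀.conductorNorm ℤ)) (β β₀ : ℤ) (ι : K →+* ℂ) (c : K ≃ₐ[ℚ] K)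
    (hPUB : PublishedInputsAdditiveKoly) (hDual : PublishedDualityInputsAdditiveKoly)
    (hKL : KrizLi2019.thm116_padicLogHeegner_congruence) (hp : 5 ≤ p) (hadd : Addv W p)
    (hs : W.HasSurjectiveModNGaloisRep p)
    (hsp : ∀ (ℓ : ℕ) [Fact ℓ.Prime], W.HasMultiplicativeReductionAtPrime ℓ → ¬ p ∣ padicValInt ℓ W.minimalDiscriminantInt)
    (htwo : ∃ (ℓ₁ ℓ₂ : ℕ) (_ : Fact ℓ₁.Prime) (_ : Fact ℓ₂.Prime), ℓ₁ ≠ ℓ₂ ∧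
      W.HasMultiplicativeReductionAtPrime ℓ₁ ∧ W.HasMultiplicativeReductionAtPrime ℓ₂)
    (htam : ¬ p ∣ W.tamagawaProduct) (hr : W.analyticRank = 1) (hK : IsImaginaryQuadratic K)
    (hodd : Odd (NumberField.discr K)) (hlt : NumberField.discr K < -4)
    (hH : SatisfiesHeegnerHypothesis (W.conductorNorm ℤ) K)
    (hL : (W.quadraticTwist (NumberField.discr K : ℚ)).entireLFunction 1 ≠ 0)
    (hβ : (4 * (W.conductorNorm ℤ : ℤ)) ∣ β ^ 2 - NumberField.discr K) (hc : ¬ (p : ℤ) ∣ Dt.c)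
    (e : geomTorsion W (p : ℤ) ≃+ geomTorsion W₀ (p : ℤ))
    (he : ∀ (σ : absoluteGaloisGroup ℚ) (P : geomTorsion W (p : ℤ)), e (σ • P) = σ • e P)
    (hgood₀ : W₀.HasGoodReductionAtPrime p) (hna : ¬ (p : ℤ) ∣ W₀.frobeniusTrace p - 1) (hs₀ : W₀.HasSurjectiveModNGaloisRep p)
    (hsp₀ : ∀ (ℓ : ℕ) [Fact ℓ.Prime], W₀.HasMultiplicativeReductionAtPrime ℓ →
      ¬ p ∣ padicValInt ℓ W₀.minimalDiscriminantInt)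
    (htam₀ : ¬ p ∣ W₀.tamagawaProduct)
    (hrad : ∀ q : ℕ, q.Prime → (q ∣ p * W.conductorNorm ℤ ↔ q ∣ p * W₀.conductorNorm ℤ))
    (hN₀ : W₀.conductorNorm ℤ * p ^ 2 = W.conductorNorm ℤ)
    (htype : ∀ (ℓ : ℕ) [Fact ℓ.Prime], W.HasMultiplicativeReductionAtPrime ℓ ↔ W₀.HasMultiplicativeReductionAtPrime ℓ)
    (hroot : W₀.rootNumber = W.rootNumber) (hH₀ : SatisfiesHeegnerHypothesis (W₀.conductorNorm ℤ) K)
    (hβ₀ : (4 * (W₀.conductorNorm ℤ : ℤ)) ∣ β₀ ^ 2 - NumberField.discr K) (hc₀ : ¬ (p : ℤ) ∣ Dt₀.c)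
    (hsign : ∀ (ℓ : ℕ) [Fact ℓ.Prime], W₀.HasMultiplicativeReductionAtPrime ℓ → W.LFunction ℓ = W₀.LFunction ℓ)
    (hc1 : c ≠ 1) [Module (ZMod p) (Vp W K p)] [Module (ZMod p) (Vp W₀ K p)]
    (hKumP : ∀ (θ : geomTorsion (W₀.baseChange K) ((p ^ 1 : ℕ) : ℤ) ≃+ geomTorsion (W.baseChange K) ((p ^ 1 : ℕ) : ℤ))
      (hθ : ∀ (g : absoluteGaloisGroup K) (P : geomTorsion (W₀.baseChange K) ((p ^ 1 : ℕ) : ℤ)), θ (g • P) = g • θ P),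
      ∀ v : HeightOneSpectrum (𝓞 K), (p : 𝓞 K) ∈ v.asIdeal →
      ∀ y : Vp W₀ K p, h1Equiv θ hθ y ∈ selmerLocalKer (W.baseChange K) (v.adicCompletion K) ((p ^ 1 : ℕ) : ℤ) ↔
        y ∈ selmerLocalKer (W₀.baseChange K) (v.adicCompletion K) ((p ^ 1 : ℕ) : ℤ))
    (hseed₀ : ∀ d₀ : KolyvaginHeegnerData Dt₀ β₀ ι 1, d₀.kolyvaginClass (Fact.out : p.Prime) 1 ≠ 0) :
    ∀ n : Finset (AdmQ W₀ K p), n.Nonempty → Even n.card →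
      Module.finrank (ZMod p) (SelQP W₀ K p c n true) + Module.finrank (ZMod p) (SelQP W₀ K p c n false) = 1 →
      Relation.EqvGen (fun a b : Finset (AdmQ W₀ K p) ↦ ∃ q, q ∉ a ∧ b = insert q a ∧
        (Even a.card → SelQP W₀ K p c (insert q a) true = ⊥ ∧ SelQP W₀ K p c (insert q a) false = ⊥) ∧
        (Odd a.card → SelQP W₀ K p c a true = ⊥ ∧ SelQP W₀ K p c a false = ⊥)) ∅ n := by
  have hpp : p.Prime := Fact.out
  have hn1 : p ^ 1 ≠ 0 := by rw [pow_one]; exact hpp.ne_zero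
  -- θ over `K̄`, commuting with the lift `liftAut c` of `c` (landed stub S2)
  obtain ⟨θ, hθ, hθτ⟩ := stub_torsionIsoBaseChange W W₀ p K c (isLiftOfAut_liftAut c) e he
  -- congruence of traces off `pN` (Kraus–Oesterlé Prop. 3 (i) ⇒ (iii))
  have ha : ∀ q : ℕ, q.Prime → ¬ q ∣ p * W.conductorNorm ℤ → (p : ℤ) ∣ W.frobeniusTrace q - W₀.frobeniusTrace q := by
    intro q hq hqn
    haveI : Fact q.Prime := ⟨hq⟩
    have hqp : q ≠ p := fun h ↦ hqn (h ▸ dvd_mul_right q _)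
    have hW : W.HasGoodReductionAtPrime q :=
      hasGoodReductionAtPrime_of_not_dvd_conductorNorm W fun h ↦ hqn (dvd_mul_of_dvd_right h p)
    have hW₀ : W₀.HasGoodReductionAtPrime q :=
      hasGoodReductionAtPrime_of_not_dvd_conductorNorm W₀ fun h ↦ hqn ((hrad q hq).mpr (dvd_mul_of_dvd_right h p))
    exact KrausOesterle1992.dvd_frobeniusTrace_sub_of_addEquiv_geomTorsion W W₀ p e he q hqp hW hW₀
  -- the admissible primes of `E` and `E₀` correspond
  have hAdm := isAdmissiblePrime_iff_of_congr K hrad ha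
  let eA : AdmQ W K p ≃ AdmQ W₀ K p := Equiv.subtypeEquivRight hAdm
  have heA : ∀ q, ((eA q : ℕ)) = (q : ℕ) := fun q ↦ Equiv.subtypeEquivRight_apply_coe hAdm q
  -- `θ_*` and its compatibilities (θc), (θK), (θT)
  have hθc : ∀ y, h1Equiv θ hθ (conjAct W₀ c ((p ^ 1 : ℕ) : ℤ) y) = conjAct W c ((p ^ 1 : ℕ) : ℤ) (h1Equiv θ hθ y) :=
    fun y ↦ h1Equiv_conjAct W W₀ θ hθ c (isLiftOfAut_liftAut c) hθτ y
  have hθK : ∀ (v : HeightOneSpectrum (𝓞 K)) (y : Vp W₀ K p),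
      h1Equiv θ hθ y ∈ selmerLocalKer (W.baseChange K) (v.adicCompletion K) ((p ^ 1 : ℕ) : ℤ) ↔
        y ∈ selmerLocalKer (W₀.baseChange K) (v.adicCompletion K) ((p ^ 1 : ℕ) : ℤ) := by
    intro v y
    by_cases hpv : (p : 𝓞 K) ∈ v.asIdeal
    · exact hKumP θ hθ v hpv y
    · by_cases hgood : (W.baseChange K).HasGoodReductionAt v ∧ (W₀.baseChange K).HasGoodReductionAt v
      · have hvn : ((((p ^ 1 : ℕ) : ℤ)) : 𝓞 K) ∉ v.asIdeal := by
          rw [pow_one, Int.cast_natCast]; exact hpv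
        exact h1Equiv_mem_selmerLocalKer_iff_of_hasGoodReductionAt (W.baseChange K) (W₀.baseChange K) θ hθ
          hgood.1 hgood.2 hvn y
      · obtain ⟨hcv, hcv₀⟩ := stub_tamagawaOffP W W₀ p K htam htam₀ hK hH hrad v hpv hgood
        exact h1Equiv_mem_selmerLocalKer_iff_of_not_dvd_localTamagawaNumber W W₀ p θ hθ hpv hcv hcv₀ y
  have hθT : ∀ (v : HeightOneSpectrum (𝓞 K)) (y : Vp W₀ K p),
      h1Equiv θ hθ y ∈ toricLocalKer (W.baseChange K) (v.adicCompletion K) ((p ^ 1 : ℕ) : ℤ) ↔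
        y ∈ toricLocalKer (W₀.baseChange K) (v.adicCompletion K) ((p ^ 1 : ℕ) : ℤ) := by
    intro v y
    haveI : CharZero (v.adicCompletion K) := charZero_of_injective_algebraMap (algebraMap K _).injective
    exact h1Equiv_mem_toricLocalKer_iff (W.baseChange K) (W₀.baseChange K) (v.adicCompletion K) hn1 θ hθ y
  -- the level dictionary `F : levels of E → levels of E₀`
  set F : Finset (AdmQ W K p) ≃ Finset (AdmQ W₀ K p) := eA.finsetCongr with hF
  have hF_mem : ∀ (a : Finset (AdmQ W K p)) (q₀ : AdmQ W₀ K p), q₀ ∈ F a ↔ eA.symm q₀ ∈ a := fun a q₀ ↦ by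
    rw [hF, Equiv.finsetCongr_apply, Finset.mem_map_equiv]
  have hF_mem' : ∀ (a : Finset (AdmQ W K p)) (q : AdmQ W K p), eA q ∈ F a ↔ q ∈ a := fun a q ↦ by
    rw [hF_mem, Equiv.symm_apply_apply]
  have hF_card : ∀ a : Finset (AdmQ W K p), (F a).card = a.card := fun a ↦ by
    rw [hF, Equiv.finsetCongr_apply, Finset.card_map]
  have hF_insert : ∀ (q : AdmQ W K p) (a : Finset (AdmQ W K p)), F (insert q a) = insert (eA q) (F a) := fun q a ↦ by
    ext x
    rw [hF_mem, Finset.mem_insert, Finset.mem_insert, hF_mem, Equiv.symm_apply_eq]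
  have hF_empty : F ∅ = ∅ := by rw [hF, Equiv.finsetCongr_apply, Finset.map_empty]
  have hfin : ∀ (a : Finset (AdmQ W K p)) (μ : Bool),
      finrank (ZMod p) (SelQP W K p c a μ) = finrank (ZMod p) (SelQP W₀ K p c (F a) μ) := fun a μ ↦
    finrank_selQP_eq_of_congr W W₀ K p c hK (h1Equiv θ hθ) hθc hθK hθT eA heA a μ
  have hbot : ∀ (a : Finset (AdmQ W K p)) (μ : Bool), SelQP W K p c a μ = ⊥ ↔ SelQP W₀ K p c (F a) μ = ⊥ := fun a μ ↦ by
    haveI := finiteDimensional_selQP W K p c a μ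
    haveI := finiteDimensional_selQP W₀ K p c (F a) μ
    rw [← Submodule.finrank_eq_zero, ← Submodule.finrank_eq_zero, hfin]
  -- E's core graph is connected from `∅` (Howard Prop. 2.4.11 at the ♯ frame, Poitou–Tate, odd bottom rank, bottom rank ≤ 1)
  have hPT : poitouTate_selmerStructure_duality K := hDual.2 K
  have hoddW := odd_finrank_selQP_empty_of_published W K p c Dt β ι hPUB hDual hp hadd hs hsp htwo htam hr hK hodd hH hL hβ hc
  have hrank₀ := finrank_selQP_empty_add_eq_one_of_seed W₀ p K c hPUB Dt₀ β₀ ι hp hs₀ hK hlt hH₀ hβ₀ hseed₀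
  have hn₀ : finrank (ZMod p) (SelQP W K p c ∅ true) + finrank (ZMod p) (SelQP W K p c ∅ false) ≤ 1 := by
    rw [hfin, hfin, hF_empty, hrank₀]
  have hconnW := selQP_coreConnected_of_poitouTate W K p hp hadd hs hK hH c hc1 hPT hoddW (n₀ := ∅) hn₀
  -- transport along `F`
  intro n hn hne hrk
  have hFn : F (F.symm n) = n := F.apply_symm_apply n
  have hW := hconnW (F.symm n)
    (by rw [← Finset.card_pos, ← hF_card, hFn, Finset.card_pos]; exact hn)
    (by rw [← hF_card, hFn]; exact hne)
    (by rw [hfin, hfin, hFn]; exact hrk)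
  -- every core edge of `E` maps to a core edge of `E₀` under `F`
  have hedge : ∀ a b : Finset (AdmQ W K p),
      (∃ q, q ∉ a ∧ b = insert q a ∧
        (Even a.card → SelQP W K p c (insert q a) true = ⊥ ∧ SelQP W K p c (insert q a) false = ⊥) ∧
        (Odd a.card → SelQP W K p c a true = ⊥ ∧ SelQP W K p c a false = ⊥)) →
      (∃ q₀, q₀ ∉ F a ∧ F b = insert q₀ (F a) ∧
        (Even (F a).card → SelQP W₀ K p c (insert q₀ (F a)) true = ⊥ ∧ SelQP W₀ K p c (insert q₀ (F a)) false = ⊥) ∧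
        (Odd (F a).card → SelQP W₀ K p c (F a) true = ⊥ ∧ SelQP W₀ K p c (F a) false = ⊥)) := by
    rintro a b ⟨q, hqa, rfl, heven, hodd'⟩
    refine ⟨eA q, fun h ↦ hqa ((hF_mem' a q).mp h), hF_insert q a, fun ha' ↦ ?_, fun ha' ↦ ?_⟩
    · rw [hF_card] at ha'
      obtain ⟨h1, h2⟩ := heven ha'
      rw [← hF_insert]
      exact ⟨(hbot _ _).mp h1, (hbot _ _).mp h2⟩
    · rw [hF_card] at ha'
      obtain ⟨h1, h2⟩ := hodd' ha'
      exact ⟨(hbot _ _).mp h1, (hbot _ _).mp h2⟩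
  rw [← hF_empty, ← hFn]
  -- push Howard's path along `F` (induction on `EqvGen`, endpoints generalized)
  generalize (∅ : Finset (AdmQ W K p)) = a₀ at hW ⊢
  generalize F.symm n = b₀ at hW ⊢
  induction hW with
  | rel x y hxy => exact Relation.EqvGen.rel _ _ (hedge x y hxy)
  | refl x => exact Relation.EqvGen.refl _
  | symm x y _ ih => exact Relation.EqvGen.symm _ _ ih
  | trans x y z _ _ ih₁ ih₂ => exact Relation.EqvGen.trans _ _ _ ih₁ ih₂

end Summit.BirchSwinnertonDyer.BirchSwinnertonDyer.Theorems.AdditiveKoly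

end
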